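import Summits.HodgeConjecture.HodgeConjecture.Theorems.Ring2HypothesesDescentAbsoluteIsogeny
import Literature.AlgebraicGeometry.HodgeTheory.HodgeConjectureAbelianSubquotients
import Literature.AlgebraicGeometry.Motives.AbelianVarietyImage
import HarnessLib

/-!
# Ring 2 — hypotheses layer, descent axis: "absolute Hodge ⟹ algebraic" IS INHERITED BY ABELIAN SUBVARIETIES,
# QUOTIENT ABELIAN VARIETIES AND IMAGES OF HOMOMORPHISMS (isogeny direct summands; Poincaré's complete reducibility)

HONEST FRAMING (page 1, verbatim the cell's standing line): **research route conditional on HC_CM; not a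
corollary; Q11.4-sentence-2 already refuted in dim ≥ 3.** Nothing in this file proves a case of the Hodge conjecture;
nothing discharges the binder of record b06 `Ring2.Hypotheses.AbsoluteHodgeImpliesAlgebraicAV` ("absolute Hodge classes
on complex abelian varieties are algebraic", `Ring2HypothesesDescent.lean` :73; OPEN, `≡ HC_AV` modulo Deligne's Main
Theorem 2.11 = fact c1); the binder table's numbers do not move. `HC_CM` (`Theses.RankFourFaces.CMAbelianHodge`) does not
occur in this file; `HC_AV` does not occur in this file.

Hodge ladder STAGE 3, `BINDER-OWNERS.md` row **b06**, seat `ring2-b06` (gen 74). Gen 73 proved that Charles–Schnell's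
Conjecture 11.2.18 AT a complex abelian variety `A` — `AbsoluteHodgeClassesAreAlgebraicFor A.dim A.X`, "every absolute
Hodge class on `A` is algebraic" — is an ISOGENY INVARIANT (modulo the pull-back facts (N)+(E)). This file proves the
stronger heredity: the property passes from `J` to `I` whenever `I` is an **isogeny direct summand** of `J` — there are
homomorphisms `t : I ⟶ J`, `h : J ⟶ I` with `t ≫ h = [n]`, `n ≠ 0` — hence (Poincaré's complete reducibility theorem,
Mumford §19 Thm. 1, PROVED in the tree) to every **abelian subvariety** `ι : I ↪ J` (the tree's THEOREM
`AbelianVariety.exists_comp_eq_nsmul_id_of_isClosedImmersion`: `ι ≫ q = [n]`), to every **quotient** `h : J ↠ I` (the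
tree's THEOREM `AbelianVariety.exists_comp_eq_nsmul_id_of_surjective`: a Poincaré complement of `(Ker h)⁰` maps
isogenously onto `I`, `t ≫ h = [n]`), to the factors of a product, and to the **image** of every homomorphism
`f : A ⟶ B` from EITHER side (`A ↠ im f ↪ B`). It is the absolute-Hodge twin of the Literature file
`HodgeTheory/HodgeConjectureAbelianSubquotients` (literature seat, this cell: `HodgeConjectureFor.of_isClosedImmersion`,
`HodgeConjectureFor.of_surjective_hom`), whose proof it follows line by line with "rational of type `(p,p)`" replaced by
"absolute Hodge":

  for an absolute Hodge class `c` on `I`, `h^* c` is absolute Hodge on `J` (pull-back stability of absolute Hodge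
  classes along `ℂ`-morphisms of smooth projective varieties — Charles–Schnell (11.2.2) `(g^*α)^σ = (g^σ)^*α^σ`,
  Deligne's Ex. 2.1 (d) — which the tree has MODULO the named facts (N) `chartConjugation_canonical` and (E) the
  existence of `σ`-conjugates of even-degree classes (⟸ (G) `grothendieck_comparison_realize_surjective`):
  `absolutePullback_of_canonical`, lane lit-hodgefound), hence algebraic by hypothesis, hence
  `t^* h^* c = n^{2p} • c` is algebraic (`complexBetti_map_map_of_comp_eq_nsmul_id`, Mumford §1 (3); pull-backs of
  algebraic classes along morphisms INTO an abelian variety are algebraic, the tree's fact-free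
  `map_mem_algebraicClasses_of_abelianVariety`, Fulton Cor. 19.2 (b) via general translates), so `c` is.

* §1 (mod (N)+(E)) isogeny direct summands, abelian subvarieties, quotients, factors of products — per codimension and
  for the predicate `AbsoluteHodgeClassesAreAlgebraicFor`; (G)-keyed forms of the two headline statements.
* §2 (mod (N)+(E)) images: `AbsoluteHodgeClassesAreAlgebraicFor` for `A` OR for `B` gives it for the image of any
  homomorphism `f : A ⟶ B` (the tree's `AbelianVariety.image f`, `toImage f` surjective, `imageι f` a closed
  immersion); the same for `HodgeConjectureFor`, FACT-FREE (a corollary of the Literature file not spelled out there).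
* §3 (mod c1 ALONE) on abelian varieties "absolute Hodge" = "rational `(p,p)`" (Deligne's Main Theorem 2.11, the
  named fact c1 `deligne1982_hodgeClasses_abelianVariety_absoluteHodge`, hypothesis), so 11.2.18 at `A` ⟺ the Hodge
  conjecture for `A`, and the heredity of §1–§2 holds modulo c1 with NEITHER (N) NOR (E) — the moduli are nested, as in
  gens 69–73.
* §4 Row b06 read through the heredity (row b06 ≡ "11.2.18 at every complex abelian variety" is gen 68's fact-free
  `absoluteHodgeImpliesAlgebraicAV_iff_forall_absoluteHodgeClassesAreAlgebraicFor`): a counterexample to row b06 on `I`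
  is a counterexample on every abelian variety of which `I` is an isogeny direct summand (every `J ↠ I`, every
  `J ↩ I`, every `I × B`, `B × I`); equivalently the class of abelian varieties satisfying 11.2.18 is closed under
  isogeny direct summands. (The generating-class form — row b06 ⟺ 11.2.18 for JACOBIANS OF CURVES, every abelian
  variety being a quotient of a Jacobian — is the companion file `Ring2HypothesesDescentAbsoluteJacobians.lean`, which
  needs that theorem of Lange–Birkenhake / Milne as a named fact.)

WHY IT IS WORTH A LINE. Every reduction step in print that replaces an abelian variety by "the abelian subvariety
generated by …", by a quotient, by a Prym or by the image of a correspondence (Schoen 1988 Cor. 3.1: the Weil classes of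
the generalized Prym `B ⊂ Alb(C)`; van Geemen 1994 §3.6–3.7; Moonen–Zarhin's passage to the simple factors; the cell's
own `WeilClassesCyclicPrymTransfer`) uses exactly this heredity on the Hodge road; the absolute road now has it BY NAME,
per variety and per codimension, so that any future algebraicity theorem for absolute Hodge classes on ONE abelian
variety `J` is immediately available on every isogeny direct summand of `J`.

HONEST COLUMN. Nothing is discharged; row b06, the general row, `HC_AV` stay OPEN and are NOT asserted; (N), (E)/(G),
c1 are named facts of the tree occurring only as hypotheses; no new definition, no new named fact, no sorry. NOT
obtained: heredity under PRODUCTS (`A`, `B` ⟹ `A × B`: false direction — Weil type), under DUALS (no dual abelian variety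
in the tree), or for the fixed-codimension slices of the general row (no abelian-variety structure to split).

PRESEARCH: «absolute Hodge classes algebraic abelian subvariety quotient isogeny direct summand» → [corpus:
book:green1994-algebraic-cycles-hodge-theory (van Geemen) §3.5–3.7 p. 236] isogeny invariance via pull-back/push-forward
of cycles; [corpus: book:lange1992-complex-abelian-varieties Cor. 2.4.24 / §5.3] complementary abelian subvarieties and
norm endomorphisms; [corpus: book:cattani2014-hodge-theory-princeton-mathematical-notes-49 §11.2.2, Conj. 11.2.18] the
pull-back compatibility and the conjecture; no printed statement of 11.2.18's heredity under subquotients found —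
certification by assembly, no novelty in print claimed.

References (bib keys): MumfordAV1970 (§1 (3); §19 Thm. 1 and Remark p. 169, pp. 169–174), LangeBirkenhake1992
(Prop. 1.1.12, Prop. 1.1.15, Cor. 2.4.24, §5.3), vanGeemen1994HodgeAV (§3.5–3.7, Lemma 3.7, p. 236),
CharlesSchnell2014Notes (§11.2.2 (11.2.1)–(11.2.3), Def. 11.2.3, §11.2.5 Conj. 11.2.18), Deligne1982HodgeCycles (§2
Ex. 2.1 (d) p. 16; Main Thm. 2.11 p. 19), Fulton1998 (§19.2 Cor. 19.2 (b)), Schoen1988HodgeWeil (Cor. 3.1). -/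

noncomputable section

set_option linter.dupNamespace false

open CategoryTheory CategoryTheory.Limits AlgebraicGeometry
open Literature.AlgebraicGeometry Literature.AlgebraicGeometry.Motives
open Literature.AlgebraicGeometry.Motives.AbelianVariety
open Literature.AlgebraicGeometry.HodgeTheory

namespace Summit.HodgeConjecture.HodgeConjecture.Ring2.Hypotheses

/-! ## §1 (mod (N)+(E)) Isogeny direct summands, abelian subvarieties, quotients, factors -/

section Summand

variable {I J : AbelianVariety ℂ}

/-- **"Absolute Hodge ⟹ algebraic" passes to an isogeny direct summand, per codimension** (modulo (N)+(E)): if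
`t : I ⟶ J`, `h : J ⟶ I` satisfy `t ≫ h = [n]` with `n ≠ 0` and every absolute Hodge class of codimension `p` on `J`
is algebraic, then every absolute Hodge class `c` of codimension `p` on `I` is algebraic — `h^* c` is absolute Hodge on
`J` (`absolutePullback_of_canonical`, Charles–Schnell (11.2.2)), hence algebraic, so `t^* h^* c = n^{2p} • c` is
algebraic (pull-back into an abelian variety, Fulton Cor. 19.2 (b)), and `n^{2p} ≠ 0`. The hypothesis on `J` is NOT
asserted. [cite: vanGeemen1994HodgeAV, §3.6–3.7 Lemma 3.7 (p. 236)] [cite: CharlesSchnell2014Notes, §11.2.2 (11.2.2)–(11.2.3)]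
[cite: MumfordAV1970, §1 (3) and §19 Remark p. 169] [cite: Fulton1998, §19.2 Cor. 19.2 (b)] -/
theorem absoluteHodge_algebraic_of_comp_eq_nsmul_id_of_canonical (hN : chartConjugation_canonical)
    (hex : ∀ ⦃n : ℕ⦄ ⦃X : SchemeOver ℂ⦄, IsSmoothProjective n X →
      ∀ (σ : ℂ ≃+* ℂ) (p : ℕ) (c : complexBetti X (2 * p)), ∃ s, IsConjugateClass σ X (2 * p) c s)
    (t : I ⟶ J) (h : J ⟶ I) {n : ℕ} (hn : n ≠ 0) (hth : t ≫ h = n • 𝟙 I) {p : ℕ}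
    (hJ : ∀ c' : complexBetti J.X (2 * p), IsAbsoluteHodgeClass J.dim J.X p c' → c' ∈ algebraicClasses J.X p)
    {c : complexBetti I.X (2 * p)} (hc : IsAbsoluteHodgeClass I.dim I.X p c) : c ∈ algebraicClasses I.X p := by
  have hI : IsSmoothProjective I.dim I.X := AbelianVariety.isSmoothProjective_holds
  have hJsp : IsSmoothProjective J.dim J.X := AbelianVariety.isSmoothProjective_holds
  -- `h^* c` is absolute Hodge on `J`, hence algebraic
  have h1 : complexBetti.map h.hom.hom.hom (2 * p) c ∈ algebraicClasses J.X p :=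
    hJ _ (absolutePullback_of_canonical hN hex hJsp hI h.hom.hom.hom p c hc)
  -- its pull-back along `t` is algebraic on `I` and equals `n^{2p} • c`
  have h2 : complexBetti.map t.hom.hom.hom (2 * p) (complexBetti.map h.hom.hom.hom (2 * p) c) ∈
      algebraicClasses I.X p :=
    map_mem_algebraicClasses_of_abelianVariety hI J t.hom.hom.hom h1
  rw [complexBetti_map_map_of_comp_eq_nsmul_id hth] at h2
  have hn' : ((n : ℂ) ^ (2 * p)) ≠ 0 := pow_ne_zero _ (Nat.cast_ne_zero.2 hn)
  have h3 := Submodule.smul_mem (algebraicClasses I.X p) (((n : ℂ) ^ (2 * p))⁻¹) h2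
  rwa [smul_smul, inv_mul_cancel₀ hn', one_smul] at h3

/-- **Charles–Schnell's 11.2.18 AT an abelian variety passes to an isogeny direct summand** (modulo (N)+(E)):
`t ≫ h = [n]`, `n ≠ 0`, and `AbsoluteHodgeClassesAreAlgebraicFor` for `J` give it for `I` (the Hodge-model conjunct of
`I` is the tree's theorem `nonempty_hodgeModel_holds`). The hypothesis on `J` is NOT asserted.
[cite: vanGeemen1994HodgeAV, §3.6–3.7 Lemma 3.7 (p. 236)] [cite: CharlesSchnell2014Notes, §11.2.5 Conj. 11.2.18] -/
theorem absoluteHodgeClassesAreAlgebraicFor_of_comp_eq_nsmul_id_of_canonical (hN : chartConjugation_canonical)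
    (hex : ∀ ⦃n : ℕ⦄ ⦃X : SchemeOver ℂ⦄, IsSmoothProjective n X →
      ∀ (σ : ℂ ≃+* ℂ) (p : ℕ) (c : complexBetti X (2 * p)), ∃ s, IsConjugateClass σ X (2 * p) c s)
    (t : I ⟶ J) (h : J ⟶ I) {n : ℕ} (hn : n ≠ 0) (hth : t ≫ h = n • 𝟙 I)
    (hJ : AbsoluteHodgeClassesAreAlgebraicFor J.dim J.X) : AbsoluteHodgeClassesAreAlgebraicFor I.dim I.X :=
  ⟨nonempty_hodgeModel_holds AbelianVariety.isSmoothProjective_holds, fun _ _ hc ↦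
    absoluteHodge_algebraic_of_comp_eq_nsmul_id_of_canonical hN hex t h hn hth (hJ.2 _) hc⟩

/-- **Absolute Hodge classes on an ABELIAN SUBVARIETY are algebraic if those of the ambient abelian variety are, per
codimension** (modulo (N)+(E); Poincaré's complete reducibility: `ι ≫ q = [n]` for a closed-immersion homomorphism
`ι : I ↪ J`, the tree's theorem `AbelianVariety.exists_comp_eq_nsmul_id_of_isClosedImmersion`). The hypothesis on `J`
is NOT asserted. [cite: MumfordAV1970, §19 Thm. 1 (pp. 173–174)] [cite: LangeBirkenhake1992, Cor. 2.4.24 and Prop. 1.1.15]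
[cite: CharlesSchnell2014Notes, §11.2.2 (11.2.2) and Conj. 11.2.18] -/
theorem absoluteHodge_algebraic_of_isClosedImmersion_of_canonical (hN : chartConjugation_canonical)
    (hex : ∀ ⦃n : ℕ⦄ ⦃X : SchemeOver ℂ⦄, IsSmoothProjective n X →
      ∀ (σ : ℂ ≃+* ℂ) (p : ℕ) (c : complexBetti X (2 * p)), ∃ s, IsConjugateClass σ X (2 * p) c s)
    (ι : I ⟶ J) [IsClosedImmersion (Hom.toSchemeHom ι)] {p : ℕ}
    (hJ : ∀ c' : complexBetti J.X (2 * p), IsAbsoluteHodgeClass J.dim J.X p c' → c' ∈ algebraicClasses J.X p)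
    {c : complexBetti I.X (2 * p)} (hc : IsAbsoluteHodgeClass I.dim I.X p c) : c ∈ algebraicClasses I.X p := by
  obtain ⟨q, n, hn, hq⟩ := exists_comp_eq_nsmul_id_of_isClosedImmersion ι
  exact absoluteHodge_algebraic_of_comp_eq_nsmul_id_of_canonical hN hex ι q hn hq hJ hc

/-- **11.2.18 descends to abelian subvarieties** (modulo (N)+(E)): for every closed-immersion homomorphism
`ι : I ↪ J` of complex abelian varieties, `AbsoluteHodgeClassesAreAlgebraicFor` for `J` gives it for `I` — the
absolute twin of the tree's `HodgeConjectureFor.of_isClosedImmersion`. The hypothesis on `J` is NOT asserted.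
[cite: MumfordAV1970, §19 Thm. 1 (pp. 173–174)] [cite: CharlesSchnell2014Notes, §11.2.5 Conj. 11.2.18] -/
theorem absoluteHodgeClassesAreAlgebraicFor_of_isClosedImmersion_of_canonical (hN : chartConjugation_canonical)
    (hex : ∀ ⦃n : ℕ⦄ ⦃X : SchemeOver ℂ⦄, IsSmoothProjective n X →
      ∀ (σ : ℂ ≃+* ℂ) (p : ℕ) (c : complexBetti X (2 * p)), ∃ s, IsConjugateClass σ X (2 * p) c s)
    (ι : I ⟶ J) [IsClosedImmersion (Hom.toSchemeHom ι)] (hJ : AbsoluteHodgeClassesAreAlgebraicFor J.dim J.X) :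
    AbsoluteHodgeClassesAreAlgebraicFor I.dim I.X := by
  obtain ⟨q, n, hn, hq⟩ := exists_comp_eq_nsmul_id_of_isClosedImmersion ι
  exact absoluteHodgeClassesAreAlgebraicFor_of_comp_eq_nsmul_id_of_canonical hN hex ι q hn hq hJ

/-- **Absolute Hodge classes on a QUOTIENT abelian variety are algebraic if those of the source are, per codimension**
(modulo (N)+(E); a surjective homomorphism `h : J ↠ I` has a quasi-section `t ≫ h = [n]`, the tree's theorem
`AbelianVariety.exists_comp_eq_nsmul_id_of_surjective` — a Poincaré complement of `(Ker h)⁰` maps isogenously onto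
`I`; ANY dimensions, compare gen 73's equidimensional `absoluteHodge_algebraic_of_surjective_of_canonical`). The
hypothesis on `J` is NOT asserted. [cite: MumfordAV1970, §19 Thm. 1 and Remark p. 169]
[cite: LangeBirkenhake1992, Prop. 1.1.12, Prop. 1.1.15 and Cor. 2.4.24] [cite: CharlesSchnell2014Notes, §11.2.2 (11.2.2) and Conj. 11.2.18] -/
theorem absoluteHodge_algebraic_of_surjective_hom_of_canonical (hN : chartConjugation_canonical)
    (hex : ∀ ⦃n : ℕ⦄ ⦃X : SchemeOver ℂ⦄, IsSmoothProjective n X →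
      ∀ (σ : ℂ ≃+* ℂ) (p : ℕ) (c : complexBetti X (2 * p)), ∃ s, IsConjugateClass σ X (2 * p) c s)
    (h : J ⟶ I) [Surjective (Hom.toSchemeHom h)] {p : ℕ}
    (hJ : ∀ c' : complexBetti J.X (2 * p), IsAbsoluteHodgeClass J.dim J.X p c' → c' ∈ algebraicClasses J.X p)
    {c : complexBetti I.X (2 * p)} (hc : IsAbsoluteHodgeClass I.dim I.X p c) : c ∈ algebraicClasses I.X p := by
  obtain ⟨t, n, hn, ht⟩ := exists_comp_eq_nsmul_id_of_surjective h
  exact absoluteHodge_algebraic_of_comp_eq_nsmul_id_of_canonical hN hex t h hn ht hJ hc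

/-- **11.2.18 descends to quotient abelian varieties** (modulo (N)+(E)): for every surjective homomorphism
`h : J ↠ I` of complex abelian varieties (any dimensions), `AbsoluteHodgeClassesAreAlgebraicFor` for `J` gives it for
`I` — the absolute twin of the tree's `HodgeConjectureFor.of_surjective_hom`. The hypothesis on `J` is NOT asserted.
[cite: MumfordAV1970, §19 Thm. 1 and Remark p. 169] [cite: CharlesSchnell2014Notes, §11.2.5 Conj. 11.2.18] -/
theorem absoluteHodgeClassesAreAlgebraicFor_of_surjective_hom_of_canonical (hN : chartConjugation_canonical)
    (hex : ∀ ⦃n : ℕ⦄ ⦃X : SchemeOver ℂ⦄, IsSmoothProjective n X →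
      ∀ (σ : ℂ ≃+* ℂ) (p : ℕ) (c : complexBetti X (2 * p)), ∃ s, IsConjugateClass σ X (2 * p) c s)
    (h : J ⟶ I) [Surjective (Hom.toSchemeHom h)] (hJ : AbsoluteHodgeClassesAreAlgebraicFor J.dim J.X) :
    AbsoluteHodgeClassesAreAlgebraicFor I.dim I.X := by
  obtain ⟨t, n, hn, ht⟩ := exists_comp_eq_nsmul_id_of_surjective h
  exact absoluteHodgeClassesAreAlgebraicFor_of_comp_eq_nsmul_id_of_canonical hN hex t h hn ht hJ

/-- **Factors of a product, first factor** (modulo (N)+(E)): 11.2.18 for `I × J` gives it for `I`, through the split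
surjection `fst : I × J ↠ I`, `(𝟙, 0) ≫ fst = 𝟙 = [1]` (compare gen 71's degree-wise padding lemmas, which need
Deligne's Ex. 2.1 (c) for the way UP but not for the way down). [cite: vanGeemen1994HodgeAV, §3.6–3.7 Lemma 3.7 (p. 236)]
[cite: MumfordAV1970, §1 (products of abelian varieties)] -/
theorem absoluteHodgeClassesAreAlgebraicFor_of_prod_fst_of_canonical (hN : chartConjugation_canonical)
    (hex : ∀ ⦃n : ℕ⦄ ⦃X : SchemeOver ℂ⦄, IsSmoothProjective n X →
      ∀ (σ : ℂ ≃+* ℂ) (p : ℕ) (c : complexBetti X (2 * p)), ∃ s, IsConjugateClass σ X (2 * p) c s)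
    (hIJ : AbsoluteHodgeClassesAreAlgebraicFor (I.prod J).dim (I.prod J).X) :
    AbsoluteHodgeClassesAreAlgebraicFor I.dim I.X :=
  absoluteHodgeClassesAreAlgebraicFor_of_comp_eq_nsmul_id_of_canonical hN hex (AbelianVariety.prodLift (𝟙 I) 0)
    (AbelianVariety.fst I J) one_ne_zero (by rw [AbelianVariety.prodLift_fst, one_smul]) hIJ

/-- **Factors of a product, second factor** (modulo (N)+(E)): 11.2.18 for `I × J` gives it for `J`, through
`(0, 𝟙) ≫ snd = 𝟙 = [1]`. [cite: vanGeemen1994HodgeAV, §3.6–3.7 Lemma 3.7 (p. 236)] [cite: MumfordAV1970, §1 (products of abelian varieties)] -/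
theorem absoluteHodgeClassesAreAlgebraicFor_of_prod_snd_of_canonical (hN : chartConjugation_canonical)
    (hex : ∀ ⦃n : ℕ⦄ ⦃X : SchemeOver ℂ⦄, IsSmoothProjective n X →
      ∀ (σ : ℂ ≃+* ℂ) (p : ℕ) (c : complexBetti X (2 * p)), ∃ s, IsConjugateClass σ X (2 * p) c s)
    (hIJ : AbsoluteHodgeClassesAreAlgebraicFor (I.prod J).dim (I.prod J).X) :
    AbsoluteHodgeClassesAreAlgebraicFor J.dim J.X :=
  absoluteHodgeClassesAreAlgebraicFor_of_comp_eq_nsmul_id_of_canonical hN hex (AbelianVariety.prodLift 0 (𝟙 J))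
    (AbelianVariety.snd I J) one_ne_zero (by rw [AbelianVariety.prodLift_snd, one_smul]) hIJ

/-- **Heredity keyed to the named facts (N), (G)** — abelian subvarieties ((E) from Grothendieck's comparison fact (G)
by `exists_isConjugateClass_even_of_grothendieck`). None of (N), (G), the hypothesis on `J` is asserted.
[cite: MumfordAV1970, §19 Thm. 1 (pp. 173–174)] [cite: CharlesSchnell2014Notes, §11.2.2 (11.2.1)–(11.2.3)] -/
theorem absoluteHodgeClassesAreAlgebraicFor_of_isClosedImmersion_of_grothendieck (hN : chartConjugation_canonical)
    (hG : grothendieck_comparison_realize_surjective) (ι : I ⟶ J) [IsClosedImmersion (Hom.toSchemeHom ι)]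
    (hJ : AbsoluteHodgeClassesAreAlgebraicFor J.dim J.X) : AbsoluteHodgeClassesAreAlgebraicFor I.dim I.X :=
  absoluteHodgeClassesAreAlgebraicFor_of_isClosedImmersion_of_canonical hN
    (exists_isConjugateClass_even_of_grothendieck hG) ι hJ

/-- **Heredity keyed to the named facts (N), (G)** — quotients. None of (N), (G), the hypothesis on `J` is asserted.
[cite: MumfordAV1970, §19 Thm. 1 and Remark p. 169] [cite: CharlesSchnell2014Notes, §11.2.2 (11.2.1)–(11.2.3)] -/
theorem absoluteHodgeClassesAreAlgebraicFor_of_surjective_hom_of_grothendieck (hN : chartConjugation_canonical)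
    (hG : grothendieck_comparison_realize_surjective) (h : J ⟶ I) [Surjective (Hom.toSchemeHom h)]
    (hJ : AbsoluteHodgeClassesAreAlgebraicFor J.dim J.X) : AbsoluteHodgeClassesAreAlgebraicFor I.dim I.X :=
  absoluteHodgeClassesAreAlgebraicFor_of_surjective_hom_of_canonical hN
    (exists_isConjugateClass_even_of_grothendieck hG) h hJ

end Summand

/-! ## §2 Images of homomorphisms, from either side -/

section Image

variable {A B : AbelianVariety ℂ} (f : A ⟶ B)

/-- **11.2.18 passes to the IMAGE of a homomorphism from its SOURCE** (modulo (N)+(E)): `A ↠ im f` is a surjective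
homomorphism onto the abelian variety `AbelianVariety.image f` (the tree's scheme-theoretic image with its induced
group structure; `toImage f` surjective). The hypothesis on `A` is NOT asserted.
[cite: MumfordAV1970, §19 Thm. 1 and Remark p. 169] [cite: CharlesSchnell2014Notes, §11.2.5 Conj. 11.2.18] -/
theorem absoluteHodgeClassesAreAlgebraicFor_image_of_source_of_canonical (hN : chartConjugation_canonical)
    (hex : ∀ ⦃n : ℕ⦄ ⦃X : SchemeOver ℂ⦄, IsSmoothProjective n X →
      ∀ (σ : ℂ ≃+* ℂ) (p : ℕ) (c : complexBetti X (2 * p)), ∃ s, IsConjugateClass σ X (2 * p) c s)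
    (hA : AbsoluteHodgeClassesAreAlgebraicFor A.dim A.X) :
    AbsoluteHodgeClassesAreAlgebraicFor (AbelianVariety.image f).dim (AbelianVariety.image f).X :=
  absoluteHodgeClassesAreAlgebraicFor_of_surjective_hom_of_canonical hN hex (AbelianVariety.toImage f) hA

/-- **11.2.18 passes to the IMAGE of a homomorphism from its TARGET** (modulo (N)+(E)): `im f ↪ B` is a
closed-immersion homomorphism (`imageι f`). The hypothesis on `B` is NOT asserted.
[cite: MumfordAV1970, §19 Thm. 1 (pp. 173–174)] [cite: CharlesSchnell2014Notes, §11.2.5 Conj. 11.2.18] -/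
theorem absoluteHodgeClassesAreAlgebraicFor_image_of_target_of_canonical (hN : chartConjugation_canonical)
    (hex : ∀ ⦃n : ℕ⦄ ⦃X : SchemeOver ℂ⦄, IsSmoothProjective n X →
      ∀ (σ : ℂ ≃+* ℂ) (p : ℕ) (c : complexBetti X (2 * p)), ∃ s, IsConjugateClass σ X (2 * p) c s)
    (hB : AbsoluteHodgeClassesAreAlgebraicFor B.dim B.X) :
    AbsoluteHodgeClassesAreAlgebraicFor (AbelianVariety.image f).dim (AbelianVariety.image f).X :=
  absoluteHodgeClassesAreAlgebraicFor_of_isClosedImmersion_of_canonical hN hex (AbelianVariety.imageι f) hB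

/-- **The Hodge conjecture passes to the image of a homomorphism from its source** — FACT-FREE (a corollary of the
Literature file's `HodgeConjectureFor.of_surjective_hom` through `toImage f`). The hypothesis on `A` is NOT asserted.
[cite: MumfordAV1970, §19 Thm. 1 and Remark p. 169] [cite: vanGeemen1994HodgeAV, §3.6–3.7 Lemma 3.7 (p. 236)] -/
theorem hodgeConjectureFor_image_of_source (hA : HodgeConjectureFor A.dim A.X) :
    HodgeConjectureFor (AbelianVariety.image f).dim (AbelianVariety.image f).X :=
  HodgeConjectureFor.of_surjective_hom (AbelianVariety.toImage f) hA

/-- **The Hodge conjecture passes to the image of a homomorphism from its target** — FACT-FREE (through the closed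
immersion `imageι f`). The hypothesis on `B` is NOT asserted. [cite: MumfordAV1970, §19 Thm. 1 (pp. 173–174)]
[cite: vanGeemen1994HodgeAV, §3.6–3.7 Lemma 3.7 (p. 236)] -/
theorem hodgeConjectureFor_image_of_target (hB : HodgeConjectureFor B.dim B.X) :
    HodgeConjectureFor (AbelianVariety.image f).dim (AbelianVariety.image f).X :=
  HodgeConjectureFor.of_isClosedImmersion (AbelianVariety.imageι f) hB

end Image

/-! ## §3 The moduli are nested: on abelian varieties the heredity holds modulo c1 alone -/

section Deligne

variable {I J : AbelianVariety ℂ}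

/-- **Granted Deligne's Main Theorem 2.11, 11.2.18 AT an abelian variety IS the Hodge conjecture for it**: absolute
Hodge classes are rational `(p,p)` classes by definition, and conversely by c1 (hypothesis
`deligne1982_hodgeClasses_abelianVariety_absoluteHodge`, NOT asserted); the tree's splitting
`hodgeConjectureFor_of_absoluteHodge_of_algebraic` / `AbsoluteHodgeClassesAreAlgebraicFor.of_hodgeConjectureFor`.
[cite: Deligne1982HodgeCycles, Main Thm. 2.11 (p. 19)] [cite: CharlesSchnell2014Notes, §11.2.5 (Conj. 11.2.17–11.2.18)] -/
theorem absoluteHodgeClassesAreAlgebraicFor_abelian_iff_hodgeConjectureFor_of_deligne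
    (hD : deligne1982_hodgeClasses_abelianVariety_absoluteHodge) (A : AbelianVariety ℂ) :
    AbsoluteHodgeClassesAreAlgebraicFor A.dim A.X ↔ HodgeConjectureFor A.dim A.X :=
  ⟨fun h ↦ hodgeConjectureFor_of_absoluteHodge_of_algebraic
      ⟨nonempty_hodgeModel_holds AbelianVariety.isSmoothProjective_holds, hD A⟩ h,
    AbsoluteHodgeClassesAreAlgebraicFor.of_hodgeConjectureFor⟩

/-- **Isogeny direct summands, modulo c1 ALONE** (no (N), no (E)): `t ≫ h = [n]`, `n ≠ 0`, c1, and 11.2.18 for `J`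
give 11.2.18 for `I` — through the Hodge road (`HodgeConjectureFor.of_comp_eq_nsmul_id`, fact-free) and the previous
lemma at both ends. c1 and the hypothesis on `J` are NOT asserted. [cite: Deligne1982HodgeCycles, Main Thm. 2.11 (p. 19)]
[cite: vanGeemen1994HodgeAV, §3.6–3.7 Lemma 3.7 (p. 236)] -/
theorem absoluteHodgeClassesAreAlgebraicFor_of_comp_eq_nsmul_id_of_deligne
    (hD : deligne1982_hodgeClasses_abelianVariety_absoluteHodge) (t : I ⟶ J) (h : J ⟶ I) {n : ℕ} (hn : n ≠ 0)
    (hth : t ≫ h = n • 𝟙 I) (hJ : AbsoluteHodgeClassesAreAlgebraicFor J.dim J.X) :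
    AbsoluteHodgeClassesAreAlgebraicFor I.dim I.X :=
  (absoluteHodgeClassesAreAlgebraicFor_abelian_iff_hodgeConjectureFor_of_deligne hD I).2
    (HodgeConjectureFor.of_comp_eq_nsmul_id t h hn hth
      ((absoluteHodgeClassesAreAlgebraicFor_abelian_iff_hodgeConjectureFor_of_deligne hD J).1 hJ))

/-- **Abelian subvarieties, modulo c1 ALONE.** c1 and the hypothesis on `J` are NOT asserted.
[cite: Deligne1982HodgeCycles, Main Thm. 2.11 (p. 19)] [cite: MumfordAV1970, §19 Thm. 1 (pp. 173–174)] -/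
theorem absoluteHodgeClassesAreAlgebraicFor_of_isClosedImmersion_of_deligne
    (hD : deligne1982_hodgeClasses_abelianVariety_absoluteHodge) (ι : I ⟶ J)
    [IsClosedImmersion (Hom.toSchemeHom ι)] (hJ : AbsoluteHodgeClassesAreAlgebraicFor J.dim J.X) :
    AbsoluteHodgeClassesAreAlgebraicFor I.dim I.X :=
  (absoluteHodgeClassesAreAlgebraicFor_abelian_iff_hodgeConjectureFor_of_deligne hD I).2
    (HodgeConjectureFor.of_isClosedImmersion ι
      ((absoluteHodgeClassesAreAlgebraicFor_abelian_iff_hodgeConjectureFor_of_deligne hD J).1 hJ))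

/-- **Quotients, modulo c1 ALONE.** c1 and the hypothesis on `J` are NOT asserted.
[cite: Deligne1982HodgeCycles, Main Thm. 2.11 (p. 19)] [cite: MumfordAV1970, §19 Thm. 1 and Remark p. 169] -/
theorem absoluteHodgeClassesAreAlgebraicFor_of_surjective_hom_of_deligne
    (hD : deligne1982_hodgeClasses_abelianVariety_absoluteHodge) (h : J ⟶ I)
    [Surjective (Hom.toSchemeHom h)] (hJ : AbsoluteHodgeClassesAreAlgebraicFor J.dim J.X) :
    AbsoluteHodgeClassesAreAlgebraicFor I.dim I.X :=
  (absoluteHodgeClassesAreAlgebraicFor_abelian_iff_hodgeConjectureFor_of_deligne hD I).2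
    (HodgeConjectureFor.of_surjective_hom h
      ((absoluteHodgeClassesAreAlgebraicFor_abelian_iff_hodgeConjectureFor_of_deligne hD J).1 hJ))

end Deligne

/-! ## §4 Row b06 read through the heredity -/

section Row

variable {I J : AbelianVariety ℂ}

/- Row b06 ≡ "11.2.18 at every complex abelian variety" is the tree's fact-free unfolding
`absoluteHodgeImpliesAlgebraicAV_iff_forall_absoluteHodgeClassesAreAlgebraicFor` (gen 68,
`Ring2HypothesesDescentAbsoluteHalvingWords.lean`); the statements below are its contrapositive readings through §1. -/

/-- **A COUNTEREXAMPLE TO ROW b06 PROPAGATES TO EVERY ABELIAN VARIETY OF WHICH ITS CARRIER IS AN ISOGENY DIRECT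
SUMMAND** (modulo (N)+(E); contrapositive of §1): if some absolute Hodge class on `I` is not algebraic and
`t ≫ h = [n]`, `n ≠ 0` for `t : I ⟶ J`, `h : J ⟶ I`, then some absolute Hodge class on `J` (of the same codimension)
is not algebraic — in particular on every `J ↠ I`, every `J ↩ I`, every `I × B` and `B × I`. Nothing is asserted
about the existence of such a class. [cite: vanGeemen1994HodgeAV, §3.6–3.7 Lemma 3.7 (p. 236)]
[cite: CharlesSchnell2014Notes, §11.2.5 Conj. 11.2.18] -/
theorem exists_absoluteHodge_not_algebraic_of_comp_eq_nsmul_id_of_canonical (hN : chartConjugation_canonical)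
    (hex : ∀ ⦃n : ℕ⦄ ⦃X : SchemeOver ℂ⦄, IsSmoothProjective n X →
      ∀ (σ : ℂ ≃+* ℂ) (p : ℕ) (c : complexBetti X (2 * p)), ∃ s, IsConjugateClass σ X (2 * p) c s)
    (t : I ⟶ J) (h : J ⟶ I) {n : ℕ} (hn : n ≠ 0) (hth : t ≫ h = n • 𝟙 I) {p : ℕ}
    (hI : ∃ c : complexBetti I.X (2 * p), IsAbsoluteHodgeClass I.dim I.X p c ∧ c ∉ algebraicClasses I.X p) :
    ∃ c' : complexBetti J.X (2 * p), IsAbsoluteHodgeClass J.dim J.X p c' ∧ c' ∉ algebraicClasses J.X p := by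
  by_contra hJ
  push Not at hJ
  obtain ⟨c, hc, hcn⟩ := hI
  exact hcn (absoluteHodge_algebraic_of_comp_eq_nsmul_id_of_canonical hN hex t h hn hth hJ hc)

/-- **If row b06 fails, it fails on every abelian variety mapping ONTO a carrier of a counterexample** (modulo
(N)+(E)). Nothing is asserted about row b06. [cite: MumfordAV1970, §19 Thm. 1 and Remark p. 169]
[cite: CharlesSchnell2014Notes, §11.2.5 Conj. 11.2.18] -/
theorem not_absoluteHodgeClassesAreAlgebraicFor_of_surjective_hom_of_canonical (hN : chartConjugation_canonical)
    (hex : ∀ ⦃n : ℕ⦄ ⦃X : SchemeOver ℂ⦄, IsSmoothProjective n X →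
      ∀ (σ : ℂ ≃+* ℂ) (p : ℕ) (c : complexBetti X (2 * p)), ∃ s, IsConjugateClass σ X (2 * p) c s)
    (h : J ⟶ I) [Surjective (Hom.toSchemeHom h)] (hI : ¬ AbsoluteHodgeClassesAreAlgebraicFor I.dim I.X) :
    ¬ AbsoluteHodgeClassesAreAlgebraicFor J.dim J.X :=
  fun hJ ↦ hI (absoluteHodgeClassesAreAlgebraicFor_of_surjective_hom_of_canonical hN hex h hJ)

/-- **If row b06 fails, it fails on every abelian variety CONTAINING a carrier of a counterexample as an abelian
subvariety** (modulo (N)+(E)). Nothing is asserted about row b06. [cite: MumfordAV1970, §19 Thm. 1 (pp. 173–174)]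
[cite: CharlesSchnell2014Notes, §11.2.5 Conj. 11.2.18] -/
theorem not_absoluteHodgeClassesAreAlgebraicFor_of_isClosedImmersion_of_canonical (hN : chartConjugation_canonical)
    (hex : ∀ ⦃n : ℕ⦄ ⦃X : SchemeOver ℂ⦄, IsSmoothProjective n X →
      ∀ (σ : ℂ ≃+* ℂ) (p : ℕ) (c : complexBetti X (2 * p)), ∃ s, IsConjugateClass σ X (2 * p) c s)
    (ι : I ⟶ J) [IsClosedImmersion (Hom.toSchemeHom ι)] (hI : ¬ AbsoluteHodgeClassesAreAlgebraicFor I.dim I.X) :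
    ¬ AbsoluteHodgeClassesAreAlgebraicFor J.dim J.X :=
  fun hJ ↦ hI (absoluteHodgeClassesAreAlgebraicFor_of_isClosedImmersion_of_canonical hN hex ι hJ)

end Row

/-! ## Audit: nothing is decided here

Every theorem above is a transfer lemma whose hypothesis is an instance of an OPEN statement (11.2.18 at an abelian
variety, row b06) or an unfolding; the named facts (N) `chartConjugation_canonical`, (G)
`grothendieck_comparison_realize_surjective`, c1 `deligne1982_hodgeClasses_abelianVariety_absoluteHodge` occur only as
hypotheses; `HC_CM` does not occur; `HC_AV` does not occur. Axiom closures: the three standard axioms only. -/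

#print axioms Summit.HodgeConjecture.HodgeConjecture.Ring2.Hypotheses.absoluteHodge_algebraic_of_comp_eq_nsmul_id_of_canonical
#print axioms Summit.HodgeConjecture.HodgeConjecture.Ring2.Hypotheses.absoluteHodgeClassesAreAlgebraicFor_of_surjective_hom_of_canonical
#print axioms Summit.HodgeConjecture.HodgeConjecture.Ring2.Hypotheses.absoluteHodgeClassesAreAlgebraicFor_of_isClosedImmersion_of_deligne

end Summit.HodgeConjecture.HodgeConjecture.Ring2.Hypotheses

end
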